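/-
Copyright (c) 2026 the pub-hodgecm-mathlib formalisation cell (harness21).  Prover seat hodgecm-mathlib-K2E4-p18 (g3), HCML Track B «K2-LIT» ∕ h413
(stmt-HodgeConjecture-24833); line (ii′), sub-letter (H♮): FILE 5 — re-centring the rank-one package from the identity to a central `ζ` (2026-09-04).
-/
import Summits.HodgeConjecture.HodgeConjecture.Theorems.K2E3RankOneUnipotentScalingTranslate             -- ★ FILE 5a (this seat): §1–§3 the translation transport and the clause lemmas
import HarnessLib

/-!
# K2 · E3 — `Theorems/K2E3RankOneUnipotentScalingPackageOfIdentity.lean` (FILE 5b): THE RANK-ONE PACKAGE AT A CENTRAL `ζ ∈ U(Φ₂)_v` FROM THE PACKAGE AT THE IDENTITY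
# (translation by a central scalar; Rogawski 1990 §8.1 Prop. 8.1.2 (a): descent to `Z(z)`; §4.9)

HCML Track B «K2-LIT», cell `pub/hodgecm-mathlib`, crux H413 = `stmt-HodgeConjecture-24833` (lane `--supports … --as helper`); seat `hodgecm-mathlib-K2E4-p18` (g3).
★ p856124 `K2E3CentralUnipotentScalingPackageOfRankOne` pays (Ψ-package♮) from (Ψ-package₂⁺) `sig_K2E3RankOneUnipotentScalingPackage` (e65356adaa469942), the rank-one
package AT A CENTRAL `ζ`.  The Cayley road (★ K2E5-p12 FILE 1∕2∕3 p855742∕p855813∕p855890 + the (SC₂) C-files p856070∕p856116∕…) lives AT THE IDENTITY.  THIS FILE: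
**(Ψ-package₂⁺ at every central ζ) ⟸ (Ψ-package₂¹ at 1)** (cand `K2/K2E4-p18/g3/sig_K2E3RankOneUnipotentScalingPackageOne.cand.K2E4-p18-g3.lean`), by translation with the
central element `ζ` — a SCALAR matrix `s·1` in `GL₂(L ⊗ L⁺_v)` (★ `exists_coe_fst_eq_smul_one_of_mem_center` at `(ζ, 1) ∈ Z(H_v)`), hence commuting with every
`GL₂`-conjugator: `Ψ^ζ(γ) := Ψ(γζ⁻¹)·ζ`, `U₀^ζ := {γ | γζ⁻¹ ∈ U₀}`, `a^ζ(u) := a(⟦out u · ζ⁻¹⟧)`, start `t·ζ`.  (U1)(U2)(E)(Z)(I)(C) are group algebra with `ζ` central;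
(U2st)(Est)(Sst) because stable conjugacy (`IsStablyConj = IsConj` in `GL₂`, ★) is invariant under translation by the central scalar; (S_H) through the homeomorphism
`(γ₁, γ₂) ↦ (γ₁ζ⁻¹, γ₂)` (★ `isLocSmooth_comp_homeomorph`); (RAY⁺) from (RAY¹) (`(Ψ^ζ)^[k](tζ) = Ψ^[k]t·ζ`, `Z(gζ) = Z(g)`); and **(SC_ζ) ⟸ (SC₁) by an EXACT translation
transport**: for `x = out u` over `ζ`, `x′ = xζ⁻¹` is unipotent with `Z(x′) = Z(x)`, `y x y⁻¹ = (y x′ y⁻¹)·ζ`, so `Φ_μ(x, K) = ∫_{U₂⧸Z(x′)} K((y x′ y⁻¹)ζ) dμ′` with `μ′` the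
transport of `μ` along `U₂ ⧸ Z(x) = U₂ ⧸ Z(x′)` (★ `cosetCongrHomeomorph (refl)`); docking at `out⟦x′⟧` (★ `exists_integral_descConj_eq_smul_integral_descConj_of_conj_eq`) and
(SC₁) at the unipotent class `⟦x′⟧` for the translated test function `K(·ζ)` give the law, the constant cancelling (FILE 4a's pattern).

* **`rankOneUnipotentScalingPackage_of_identity : ‹(Ψ-package₂¹)› → ‹(Ψ-package₂⁺) e65356ad VERBATIM›`** — THE HEAD; the transport (SC_ζ) ⟸ (SC₁) and the clause lemmas are
  ★ FILE 5a `Theorems/K2E3RankOneUnipotentScalingTranslate.lean` (this seat).  Kernel note: membership in the translated neighbourhood `{γ | γζ⁻¹ ∈ U₀}` is always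
  unfolded by `rw [Set.mem_setOf_eq]`, never by bare definitional unfolding (which sends the kernel into the matrix product over `L ⊗ L⁺_v`).

HONEST LABEL: HC_CM is proved only modulo the 7 printed citations (2 remaining named inputs: hLiu418 = stmt-HodgeConjecture-24832, h413 = stmt-HodgeConjecture-24833) until rung 0 closes.
Count-neutral helper: (Ψ-package₂⁺) becomes REL ⟸ (Ψ-package₂¹).  No `sorry`, axioms ⊆ {propext, Classical.choice, Quot.sound}, no `def`, no instance, no notation.

## References
* [Rogawski1990] J. D. Rogawski, *Automorphic Representations of Unitary Groups in Three Variables*, Ann. of Math. Stud. 123 (1990): §8.1 Props. 8.1.1–8.1.2 pp. 112–114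
  (descent to the centraliser of a semisimple element; homogeneity), §4.9 p. 54, §3.5 Prop. 3.5.2 (c) pp. 25–26.
* [HarishChandra1999AdmissibleDistributions] Harish-Chandra (notes by S. DeBacker, P. J. Sally, Jr.), AMS ULS 16 (1999): §3.1 Lemma 3.2.
* [Folland1995] G. B. Folland, *A Course in Abstract Harmonic Analysis* (1995), Thm. 2.49.
-/

set_option autoImplicit false
set_option linter.dupNamespace false

noncomputable section

open Filter Topology
open MeasureTheory Measure NumberField IsDedekindDomain
open Literature.MeasureTheory.Group Literature.MeasureTheory.RestrictedProduct
open Literature.Topology.RestrictedProduct Literature.Topology.Algebra.RestrictedProduct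
open Literature.NumberTheory.Rogawski1990 Literature.NumberTheory.Automorphic
open Literature.AlgebraicGeometry.ShimuraVarieties (unitaryGroup hermForm)
open scoped Matrix MatrixGroups RestrictedProduct NNReal
open Summit.HodgeConjecture.HodgeConjecture.Cruxes.H413.K2E3CentralUnipotentScalingOfFactor
open Summit.HodgeConjecture.HodgeConjecture.Cruxes.H413.K2E3RankOneUnipotentScalingTranslate
namespace Summit.HodgeConjecture.HodgeConjecture.Cruxes.H413.K2E3RankOneUnipotentScalingPackageOfIdentity

/-! ## §4 The head: the package at a central `ζ` from the package at `1` -/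

/-- **(Ψ-package₂⁺) ⟸ (Ψ-package₂¹): RE-CENTRING THE RANK-ONE PACKAGE AT A CENTRAL `ζ`.**  Hypothesis = the cand `…U3bCentralGerms.sig_K2E3RankOneUnipotentScalingPackageOne`
VERBATIM; conclusion = (Ψ-package₂⁺) `…U3bCentralGerms.sig_K2E3RankOneUnipotentScalingPackage` (e65356adaa469942, consumed by ★ p856124) VERBATIM.  Construction: module docstring.
[cite: Rogawski1990, §8.1 Prop. 8.1.2 (a)(b) p. 114; §4.9 p. 54; §3.5 Prop. 3.5.2 (c) pp. 25–26] -/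
theorem rankOneUnipotentScalingPackage_of_identity
    (hpkg :
    ∀ (L : Type) [Field L] [NumberField L] [IsCMField L] (v : HeightOneSpectrum (𝓞 ↥(maximalRealSubfield L)))
      [MeasurableSpace ((UnitaryGroup.cmDatum L 2 (Matrix.of fun i j : Fin 2 => if i.val + j.val + 1 = 2 then (1 : L) else 0)).Local v)] [BorelSpace ((UnitaryGroup.cmDatum L 2 (Matrix.of fun i j : Fin 2 => if i.val + j.val + 1 = 2 then (1 : L) else 0)).Local v)]
      [∀ γ : (UnitaryGroup.cmDatum L 2 (Matrix.of fun i j : Fin 2 => if i.val + j.val + 1 = 2 then (1 : L) else 0)).Local v, MeasurableSpace ((UnitaryGroup.cmDatum L 2 (Matrix.of fun i j : Fin 2 => if i.val + j.val + 1 = 2 then (1 : L) else 0)).Local v ⧸ Subgroup.centralizer ({γ} : Set ((UnitaryGroup.cmDatum L 2 (Matrix.of fun i j : Fin 2 => if i.val + j.val + 1 = 2 then (1 : L) else 0)).Local v)))]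
      [∀ γ : (UnitaryGroup.cmDatum L 2 (Matrix.of fun i j : Fin 2 => if i.val + j.val + 1 = 2 then (1 : L) else 0)).Local v, BorelSpace ((UnitaryGroup.cmDatum L 2 (Matrix.of fun i j : Fin 2 => if i.val + j.val + 1 = 2 then (1 : L) else 0)).Local v ⧸ Subgroup.centralizer ({γ} : Set ((UnitaryGroup.cmDatum L 2 (Matrix.of fun i j : Fin 2 => if i.val + j.val + 1 = 2 then (1 : L) else 0)).Local v)))],
      Subsingleton (UnitaryGroup.PlacesOver L v) →
    ∃ (Ψ : (UnitaryGroup.cmDatum L 2 (Matrix.of fun i j : Fin 2 => if i.val + j.val + 1 = 2 then (1 : L) else 0)).Local v → (UnitaryGroup.cmDatum L 2 (Matrix.of fun i j : Fin 2 => if i.val + j.val + 1 = 2 then (1 : L) else 0)).Local v) (U₀ : Set ((UnitaryGroup.cmDatum L 2 (Matrix.of fun i j : Fin 2 => if i.val + j.val + 1 = 2 then (1 : L) else 0)).Local v)) (q : ℂ) (a : ConjClasses ((UnitaryGroup.cmDatum L 2 (Matrix.of fun i j : Fin 2 => if i.val + j.val + 1 = 2 then (1 : L) else 0)).Local v) →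 ℕ),
      U₀ ∈ 𝓝 (1 : (UnitaryGroup.cmDatum L 2 (Matrix.of fun i j : Fin 2 => if i.val + j.val + 1 = 2 then (1 : L) else 0)).Local v) ∧
      (∀ γ ∈ U₀, ∀ x : (UnitaryGroup.cmDatum L 2 (Matrix.of fun i j : Fin 2 => if i.val + j.val + 1 = 2 then (1 : L) else 0)).Local v, x * γ * x⁻¹ ∈ U₀) ∧
      (∀ γ ∈ U₀, ∀ δ : (UnitaryGroup.cmDatum L 2 (Matrix.of fun i j : Fin 2 => if i.val + j.val + 1 = 2 then (1 : L) else 0)).Local v, IsLocalStablyConjH L v (γ, (1 : (UnitaryGroup.cmDatum L 1 (Matrix.of fun i j : Fin 1 => if i.val + j.val + 1 = 1 then (1 : L) else 0)).Local v)) (δ, (1 : (UnitaryGroup.cmDatum L 1 (Matrix.of fun i j : Fin 1 => if i.val + j.val + 1 = 1 then (1 : L) else 0)).Local v)) → δ ∈ U₀) ∧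
      (∀ γ ∈ U₀, ∀ x : (UnitaryGroup.cmDatum L 2 (Matrix.of fun i j : Fin 2 => if i.val + j.val + 1 = 2 then (1 : L) else 0)).Local v, Ψ (x * γ * x⁻¹) = x * Ψ γ * x⁻¹) ∧
      (∀ γ ∈ U₀, ∀ y : (UnitaryGroup.cmDatum L 2 (Matrix.of fun i j : Fin 2 => if i.val + j.val + 1 = 2 then (1 : L) else 0)).Local v, y * γ = γ * y ↔ y * Ψ γ = Ψ γ * y) ∧
      (∀ γ ∈ U₀, ∀ δ ∈ U₀, IsLocalStablyConjH L v (γ, (1 : (UnitaryGroup.cmDatum L 1 (Matrix.of fun i j : Fin 1 => if i.val + j.val + 1 = 1 then (1 : L) else 0)).Local v)) (δ, (1 : (UnitaryGroup.cmDatum L 1 (Matrix.of fun i j : Fin 1 => if i.val + j.val + 1 = 1 then (1 : L) else 0)).Local v)) → IsLocalStablyConjH L v (Ψ γ, (1 : (UnitaryGroup.cmDatum L 1 (Matrix.of fun i j : Fin 1 => if i.val + j.val + 1 = 1 then (1 : L) else 0)).Local v)) (Ψ δ, (1 : (UnitaryGroup.cmDatum L 1 (Matrix.of fun i j : Fin 1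 => if i.val + j.val + 1 = 1 then (1 : L) else 0)).Local v))) ∧
      (∀ γ ∈ U₀, ∀ δ ∈ U₀, Ψ γ = Ψ δ → γ = δ) ∧
      (∀ γ ∈ U₀, ∀ η : (UnitaryGroup.cmDatum L 2 (Matrix.of fun i j : Fin 2 => if i.val + j.val + 1 = 2 then (1 : L) else 0)).Local v, IsLocalStablyConjH L v (Ψ γ, (1 : (UnitaryGroup.cmDatum L 1 (Matrix.of fun i j : Fin 1 => if i.val + j.val + 1 = 1 then (1 : L) else 0)).Local v)) (η, (1 : (UnitaryGroup.cmDatum L 1 (Matrix.of fun i j : Fin 1 => if i.val + j.val + 1 = 1 then (1 : L) else 0)).Local v)) → ∃ δ ∈ U₀, IsLocalStablyConjH L v (γ, (1 : (UnitaryGroup.cmDatum L 1 (Matrix.of fun i j : Fin 1 => if i.val + j.val + 1 = 1 then (1 : L) else 0)).Local v)) (δ, (1 : (UnitaryGroup.cmDatum L 1 (Matrix.of fun i j : Fin 1 => if i.val + j.val + 1 = 1 then (1 : L) else 0)).Local v)) ∧ Ψ δ = η) ∧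
      (∀ γ ∈ U₀, Ψ γ ∈ U₀) ∧
      (∀ F : (UnitaryGroup.cmDatum L 2 (Matrix.of fun i j : Fin 2 => if i.val + j.val + 1 = 2 then (1 : L) else 0)).Local v × (UnitaryGroup.cmDatum L 1 (Matrix.of fun i j : Fin 1 => if i.val + j.val + 1 = 1 then (1 : L) else 0)).Local v → ℂ, IsLocSmooth F →
        IsLocSmooth ((U₀ ×ˢ (Set.univ : Set ((UnitaryGroup.cmDatum L 1 (Matrix.of fun i j : Fin 1 => if i.val + j.val + 1 = 1 then (1 : L) else 0)).Local v))).indicator (F ∘ fun γ : (UnitaryGroup.cmDatum L 2 (Matrix.of fun i j : Fin 2 => if i.val + j.val + 1 = 2 then (1 : L) else 0)).Local v × (UnitaryGroup.cmDatum L 1 (Matrix.of fun i j : Fin 1 => if i.val + j.val + 1 = 1 then (1 : L) else 0)).Local v => (Ψ γ.1, γ.2)))) ∧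
      1 < ‖q‖ ∧
      (∀ u : ConjClasses ((UnitaryGroup.cmDatum L 2 (Matrix.of fun i j : Fin 2 => if i.val + j.val + 1 = 2 then (1 : L) else 0)).Local v), u ≠ ConjClasses.mk 1 → 1 ≤ a u) ∧
      (∀ ζ : (UnitaryGroup.cmDatum L 2 (Matrix.of fun i j : Fin 2 => if i.val + j.val + 1 = 2 then (1 : L) else 0)).Local v, ζ ∈ Subgroup.center ((UnitaryGroup.cmDatum L 2 (Matrix.of fun i j : Fin 2 => if i.val + j.val + 1 = 2 then (1 : L) else 0)).Local v) → ∀ lam : (UnitaryGroup.cmDatum L 1 (Matrix.of fun i j : Fin 1 => if i.val + j.val + 1 = 1 then (1 : L) else 0)).Local v, ∃ t : (UnitaryGroup.cmDatum L 2 (Matrix.of fun i j : Fin 2 => if i.val + j.val + 1 = 2 then (1 : L) else 0)).Local v, t ∈ U₀ ∧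
        (∀ k : ℕ, IsLocalGRegular L v (Ψ^[k] t * ζ, lam)) ∧
        (∀ k : ℕ, CompactSpace (Subgroup.centralizer ({Ψ^[k] t} : Set ((UnitaryGroup.cmDatum L 2 (Matrix.of fun i j : Fin 2 => if i.val + j.val + 1 = 2 then (1 : L) else 0)).Local v)))) ∧
        (∀ k : ℕ, Irreducible (((Ψ^[k] t * ζ : (UnitaryGroup.cmDatum L 2 (Matrix.of fun i j : Fin 2 => if i.val + j.val + 1 = 2 then (1 : L) else 0)).Local v).val : GL (Fin 2) (UnitaryGroup.LocalRing L v)).val.charpoly)) ∧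
        Tendsto (fun k : ℕ => Ψ^[k] t) atTop (𝓝 1)) ∧
      ∀ (S₁ : Finset (ConjClasses ((UnitaryGroup.cmDatum L 2 (Matrix.of fun i j : Fin 2 => if i.val + j.val + 1 = 2 then (1 : L) else 0)).Local v))) (mU₁ : OrbitalMeasureFamily ((UnitaryGroup.cmDatum L 2 (Matrix.of fun i j : Fin 2 => if i.val + j.val + 1 = 2 then (1 : L) else 0)).Local v)),
        (∀ u ∈ S₁, (((Quotient.out u : (UnitaryGroup.cmDatum L 2 (Matrix.of fun i j : Fin 2 => if i.val + j.val + 1 = 2 then (1 : L) else 0)).Local v).val : GL (Fin 2) (UnitaryGroup.LocalRing L v)).val - 1) ^ 2 = 0) →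
        mU₁.IsAdmissibleOn (fun γ : (UnitaryGroup.cmDatum L 2 (Matrix.of fun i j : Fin 2 => if i.val + j.val + 1 = 2 then (1 : L) else 0)).Local v => ConjClasses.mk γ ∈ S₁) →
        ∀ u ∈ S₁, ∀ G : (UnitaryGroup.cmDatum L 2 (Matrix.of fun i j : Fin 2 => if i.val + j.val + 1 = 2 then (1 : L) else 0)).Local v → ℂ, IsLocSmooth G →
          classOrbitalIntegral mU₁ (U₀.indicator (G ∘ Ψ)) u = q ^ (a u) * classOrbitalIntegral mU₁ G u) :
    ∀ (L : Type) [Field L] [NumberField L] [IsCMField L] (v : HeightOneSpectrum (𝓞 ↥(maximalRealSubfield L)))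
      [MeasurableSpace ((UnitaryGroup.cmDatum L 2 (Matrix.of fun i j : Fin 2 => if i.val + j.val + 1 = 2 then (1 : L) else 0)).Local v)] [BorelSpace ((UnitaryGroup.cmDatum L 2 (Matrix.of fun i j : Fin 2 => if i.val + j.val + 1 = 2 then (1 : L) else 0)).Local v)]
      [∀ γ : (UnitaryGroup.cmDatum L 2 (Matrix.of fun i j : Fin 2 => if i.val + j.val + 1 = 2 then (1 : L) else 0)).Local v, MeasurableSpace ((UnitaryGroup.cmDatum L 2 (Matrix.of fun i j : Fin 2 => if i.val + j.val + 1 = 2 then (1 : L) else 0)).Local v ⧸ Subgroup.centralizer ({γ} : Set ((UnitaryGroup.cmDatum L 2 (Matrix.of fun i j : Fin 2 => if i.val + j.val + 1 = 2 then (1 : L) else 0)).Local v)))]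
      [∀ γ : (UnitaryGroup.cmDatum L 2 (Matrix.of fun i j : Fin 2 => if i.val + j.val + 1 = 2 then (1 : L) else 0)).Local v, BorelSpace ((UnitaryGroup.cmDatum L 2 (Matrix.of fun i j : Fin 2 => if i.val + j.val + 1 = 2 then (1 : L) else 0)).Local v ⧸ Subgroup.centralizer ({γ} : Set ((UnitaryGroup.cmDatum L 2 (Matrix.of fun i j : Fin 2 => if i.val + j.val + 1 = 2 then (1 : L) else 0)).Local v)))],
      Subsingleton (UnitaryGroup.PlacesOver L v) →
    ∀ ζ : (UnitaryGroup.cmDatum L 2 (Matrix.of fun i j : Fin 2 => if i.val + j.val + 1 = 2 then (1 : L) else 0)).Local v, ζ ∈ Subgroup.center ((UnitaryGroup.cmDatum L 2 (Matrix.of fun i j : Fin 2 => if i.val + j.val + 1 = 2 then (1 : L) else 0)).Local v) →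
    ∃ (Ψ : (UnitaryGroup.cmDatum L 2 (Matrix.of fun i j : Fin 2 => if i.val + j.val + 1 = 2 then (1 : L) else 0)).Local v → (UnitaryGroup.cmDatum L 2 (Matrix.of fun i j : Fin 2 => if i.val + j.val + 1 = 2 then (1 : L) else 0)).Local v) (U₀ : Set ((UnitaryGroup.cmDatum L 2 (Matrix.of fun i j : Fin 2 => if i.val + j.val + 1 = 2 then (1 : L) else 0)).Local v)) (q : ℂ) (a : ConjClasses ((UnitaryGroup.cmDatum L 2 (Matrix.of fun i j : Fin 2 => if i.val + j.val + 1 = 2 then (1 : L) else 0)).Local v) → ℕ),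
      U₀ ∈ 𝓝 ζ ∧
      (∀ γ ∈ U₀, ∀ x : (UnitaryGroup.cmDatum L 2 (Matrix.of fun i j : Fin 2 => if i.val + j.val + 1 = 2 then (1 : L) else 0)).Local v, x * γ * x⁻¹ ∈ U₀) ∧
      (∀ γ ∈ U₀, ∀ δ : (UnitaryGroup.cmDatum L 2 (Matrix.of fun i j : Fin 2 => if i.val + j.val + 1 = 2 then (1 : L) else 0)).Local v, IsLocalStablyConjH L v (γ, (1 : (UnitaryGroup.cmDatum L 1 (Matrix.of fun i j : Fin 1 => if i.val + j.val + 1 = 1 then (1 : L) else 0)).Local v)) (δ, (1 : (UnitaryGroup.cmDatum L 1 (Matrix.of fun i j : Fin 1 => if i.val + j.val + 1 = 1 then (1 : L) else 0)).Local v)) → δ ∈ U₀) ∧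
      (∀ γ ∈ U₀, ∀ x : (UnitaryGroup.cmDatum L 2 (Matrix.of fun i j : Fin 2 => if i.val + j.val + 1 = 2 then (1 : L) else 0)).Local v, Ψ (x * γ * x⁻¹) = x * Ψ γ * x⁻¹) ∧
      (∀ γ ∈ U₀, ∀ y : (UnitaryGroup.cmDatum L 2 (Matrix.of fun i j : Fin 2 => if i.val + j.val + 1 = 2 then (1 : L) else 0)).Local v, y * γ = γ * y ↔ y * Ψ γ = Ψ γ * y) ∧
      (∀ γ ∈ U₀, ∀ δ ∈ U₀, IsLocalStablyConjH L v (γ, (1 : (UnitaryGroup.cmDatum L 1 (Matrix.of fun i j : Fin 1 => if i.val + j.val + 1 = 1 then (1 : L) else 0)).Local v)) (δ, (1 : (UnitaryGroup.cmDatum L 1 (Matrix.of fun i j : Fin 1 => if i.val + j.val + 1 = 1 then (1 : L) else 0)).Local v)) → IsLocalStablyConjH L v (Ψ γ, (1 : (UnitaryGroup.cmDatum L 1 (Matrix.of fun i j : Fin 1 => if i.val + j.val + 1 = 1 then (1 : L) else 0)).Local v)) (Ψ δ, (1 : (UnitaryGroup.cmDatum L 1 (Matrix.of fun i j : Fin 1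 => if i.val + j.val + 1 = 1 then (1 : L) else 0)).Local v))) ∧
      (∀ γ ∈ U₀, ∀ δ ∈ U₀, Ψ γ = Ψ δ → γ = δ) ∧
      (∀ γ ∈ U₀, ∀ η : (UnitaryGroup.cmDatum L 2 (Matrix.of fun i j : Fin 2 => if i.val + j.val + 1 = 2 then (1 : L) else 0)).Local v, IsLocalStablyConjH L v (Ψ γ, (1 : (UnitaryGroup.cmDatum L 1 (Matrix.of fun i j : Fin 1 => if i.val + j.val + 1 = 1 then (1 : L) else 0)).Local v)) (η, (1 : (UnitaryGroup.cmDatum L 1 (Matrix.of fun i j : Fin 1 => if i.val + j.val + 1 = 1 then (1 : L) else 0)).Local v)) → ∃ δ ∈ U₀, IsLocalStablyConjH L v (γ, (1 : (UnitaryGroup.cmDatum L 1 (Matrix.of fun i j : Fin 1 => if i.val + j.val + 1 = 1 then (1 : L) else 0)).Local v)) (δ, (1 : (UnitaryGroup.cmDatum L 1 (Matrix.of fun i j : Fin 1 => if i.val + j.val + 1 = 1 then (1 : L) else 0)).Local v)) ∧ Ψ δ = η) ∧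
      (∀ γ ∈ U₀, Ψ γ ∈ U₀) ∧
      (∀ F : (UnitaryGroup.cmDatum L 2 (Matrix.of fun i j : Fin 2 => if i.val + j.val + 1 = 2 then (1 : L) else 0)).Local v × (UnitaryGroup.cmDatum L 1 (Matrix.of fun i j : Fin 1 => if i.val + j.val + 1 = 1 then (1 : L) else 0)).Local v → ℂ, IsLocSmooth F →
        IsLocSmooth ((U₀ ×ˢ (Set.univ : Set ((UnitaryGroup.cmDatum L 1 (Matrix.of fun i j : Fin 1 => if i.val + j.val + 1 = 1 then (1 : L) else 0)).Local v))).indicator (F ∘ fun γ : (UnitaryGroup.cmDatum L 2 (Matrix.of fun i j : Fin 2 => if i.val + j.val + 1 = 2 then (1 : L) else 0)).Local v × (UnitaryGroup.cmDatum L 1 (Matrix.of fun i j : Fin 1 => if i.val + j.val + 1 = 1 then (1 : L) else 0)).Local v => (Ψ γ.1, γ.2)))) ∧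
      1 < ‖q‖ ∧
      (∀ u : ConjClasses ((UnitaryGroup.cmDatum L 2 (Matrix.of fun i j : Fin 2 => if i.val + j.val + 1 = 2 then (1 : L) else 0)).Local v), u ≠ ConjClasses.mk ζ → 1 ≤ a u) ∧
      (∀ lam : (UnitaryGroup.cmDatum L 1 (Matrix.of fun i j : Fin 1 => if i.val + j.val + 1 = 1 then (1 : L) else 0)).Local v, ∃ t : (UnitaryGroup.cmDatum L 2 (Matrix.of fun i j : Fin 2 => if i.val + j.val + 1 = 2 then (1 : L) else 0)).Local v, t ∈ U₀ ∧
        (∀ k : ℕ, IsLocalGRegular L v (Ψ^[k] t, lam)) ∧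
        (∀ k : ℕ, CompactSpace (Subgroup.centralizer ({Ψ^[k] t} : Set ((UnitaryGroup.cmDatum L 2 (Matrix.of fun i j : Fin 2 => if i.val + j.val + 1 = 2 then (1 : L) else 0)).Local v)))) ∧
        (∀ k : ℕ, Irreducible (((Ψ^[k] t).val : GL (Fin 2) (UnitaryGroup.LocalRing L v)).val.charpoly)) ∧
        Tendsto (fun k : ℕ => Ψ^[k] t) atTop (𝓝 ζ)) ∧
      ∀ (S₂ : Finset (ConjClasses ((UnitaryGroup.cmDatum L 2 (Matrix.of fun i j : Fin 2 => if i.val + j.val + 1 = 2 then (1 : L) else 0)).Local v))) (mU₂ : OrbitalMeasureFamily ((UnitaryGroup.cmDatum L 2 (Matrix.of fun i j : Fin 2 => if i.val + j.val + 1 = 2 then (1 : L) else 0)).Local v)),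
        (∀ u ∈ S₂, (((Quotient.out u * ζ⁻¹ : (UnitaryGroup.cmDatum L 2 (Matrix.of fun i j : Fin 2 => if i.val + j.val + 1 = 2 then (1 : L) else 0)).Local v).val : GL (Fin 2) (UnitaryGroup.LocalRing L v)).val - 1) ^ 2 = 0) →
        mU₂.IsAdmissibleOn (fun γ : (UnitaryGroup.cmDatum L 2 (Matrix.of fun i j : Fin 2 => if i.val + j.val + 1 = 2 then (1 : L) else 0)).Local v => ConjClasses.mk γ ∈ S₂) →
        ∀ u ∈ S₂, ∀ G : (UnitaryGroup.cmDatum L 2 (Matrix.of fun i j : Fin 2 => if i.val + j.val + 1 = 2 then (1 : L) else 0)).Local v → ℂ, IsLocSmooth G →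
          classOrbitalIntegral mU₂ (U₀.indicator (G ∘ Ψ)) u = q ^ (a u) * classOrbitalIntegral mU₂ G u := by
  intro L _ _ _ v _ _ _ _ hns ζ hζ
  obtain ⟨Ψ, U₀, q, a, hU1, hU2, hU2st, hE, hZ, hEst, hI, hSst, hC, hS, hq, ha, hRAY, hSC⟩ := hpkg L v hns
  have hζc : ∀ k : (UnitaryGroup.cmDatum L 2 (Matrix.of fun i j : Fin 2 => if i.val + j.val + 1 = 2 then (1 : L) else 0)).Local v, k * ζ = ζ * k := fun k => Subgroup.mem_center_iff.1 hζ k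
  have hζi : ∀ k : (UnitaryGroup.cmDatum L 2 (Matrix.of fun i j : Fin 2 => if i.val + j.val + 1 = 2 then (1 : L) else 0)).Local v, k * ζ⁻¹ = ζ⁻¹ * k := comm_inv_of_comm hζc
  -- stable conjugacy of translates by the central scalars `ζ`, `ζ⁻¹`
  have hst_div : ∀ γ δ : (UnitaryGroup.cmDatum L 2 (Matrix.of fun i j : Fin 2 => if i.val + j.val + 1 = 2 then (1 : L) else 0)).Local v, IsLocalStablyConjH L v (γ, (1 : (UnitaryGroup.cmDatum L 1 (Matrix.of fun i j : Fin 1 => if i.val + j.val + 1 = 1 then (1 : L) else 0)).Local v)) (δ, (1 : (UnitaryGroup.cmDatum L 1 (Matrix.of fun i j : Fin 1 => if i.val + j.val + 1 = 1 then (1 : L) else 0)).Local v)) → IsLocalStablyConjH L v (γ * ζ⁻¹, (1 : (UnitaryGroup.cmDatum L 1 (Matrix.of fun i j : Fin 1 => if i.val + j.val + 1 = 1 then (1 : L) else 0)).Local v)) (δ * ζ⁻¹, (1 : (UnitaryGroup.cmDatum L 1 (Matrix.of fun i j : Fin 1 => if i.val + j.val + 1 = 1 then (1 : L) else 0)).Local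 v)) :=
    fun γ δ h => isLocalStablyConjH_mul_right L v (coe_mul_comm_of_mem_center L v hns (inv_mem hζ)) h
  have hst_mul : ∀ γ δ : (UnitaryGroup.cmDatum L 2 (Matrix.of fun i j : Fin 2 => if i.val + j.val + 1 = 2 then (1 : L) else 0)).Local v, IsLocalStablyConjH L v (γ, (1 : (UnitaryGroup.cmDatum L 1 (Matrix.of fun i j : Fin 1 => if i.val + j.val + 1 = 1 then (1 : L) else 0)).Local v)) (δ, (1 : (UnitaryGroup.cmDatum L 1 (Matrix.of fun i j : Fin 1 => if i.val + j.val + 1 = 1 then (1 : L) else 0)).Local v)) → IsLocalStablyConjH L v (γ * ζ, (1 : (UnitaryGroup.cmDatum L 1 (Matrix.of fun i j : Fin 1 => if i.val + j.val + 1 = 1 then (1 : L) else 0)).Local v)) (δ * ζ, (1 : (UnitaryGroup.cmDatum L 1 (Matrix.of fun i j : Fin 1 => if i.val + j.val + 1 = 1 then (1 : L) else 0)).Local v)) :=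
    fun γ δ h => isLocalStablyConjH_mul_right L v (coe_mul_comm_of_mem_center L v hns hζ) h
  refine ⟨fun γ => Ψ (γ * ζ⁻¹) * ζ, {γ : (UnitaryGroup.cmDatum L 2 (Matrix.of fun i j : Fin 2 => if i.val + j.val + 1 = 2 then (1 : L) else 0)).Local v | γ * ζ⁻¹ ∈ U₀}, q, fun u => a (ConjClasses.mk (Quotient.out u * ζ⁻¹)),
    translate_mem_nhds L v hU1 ζ, ?_, ?_, ?_, ?_, ?_, ?_, ?_, ?_, isLocSmooth_indicator_translate L v Ψ U₀ ζ hS, hq, ?_, ?_, ?_⟩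
  · -- (U2): membership is unfolded by `rw [Set.mem_setOf_eq]` (never by bare defeq: the kernel would dive into the matrix product)
    intro γ hγ x
    rw [Set.mem_setOf_eq] at hγ ⊢
    rw [← conj_mul_central hζi x γ]
    exact hU2 _ hγ x
  · -- (U2st)
    intro γ hγ δ hst
    rw [Set.mem_setOf_eq] at hγ ⊢
    exact hU2st _ hγ _ (hst_div γ δ hst)
  · -- (E)
    intro γ hγ x
    rw [Set.mem_setOf_eq] at hγ
    show Ψ (x * γ * x⁻¹ * ζ⁻¹) * ζ = x * (Ψ (γ * ζ⁻¹) * ζ) * x⁻¹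
    rw [← conj_mul_central hζi x γ, hE _ hγ x, conj_mul_central hζc x]
  · -- (Z)
    intro γ hγ y
    rw [Set.mem_setOf_eq] at hγ
    show y * γ = γ * y ↔ y * (Ψ (γ * ζ⁻¹) * ζ) = Ψ (γ * ζ⁻¹) * ζ * y
    rw [comm_mul_central_iff hζc y (Ψ (γ * ζ⁻¹)), ← hZ _ hγ y, ← comm_mul_central_iff hζi y γ]
  · -- (Est)
    intro γ hγ δ hδ hst
    rw [Set.mem_setOf_eq] at hγ hδ
    exact hst_mul _ _ (hEst _ hγ _ hδ (hst_div γ δ hst))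
  · -- (I)
    intro γ hγ δ hδ h
    rw [Set.mem_setOf_eq] at hγ hδ
    have h1 : Ψ (γ * ζ⁻¹) = Ψ (δ * ζ⁻¹) := mul_right_cancel h
    have h2 : γ * ζ⁻¹ = δ * ζ⁻¹ := hI _ hγ _ hδ h1
    exact mul_right_cancel h2
  · -- (Sst)
    intro γ hγ η hst
    rw [Set.mem_setOf_eq] at hγ
    have hst' : IsLocalStablyConjH L v (Ψ (γ * ζ⁻¹), (1 : (UnitaryGroup.cmDatum L 1 (Matrix.of fun i j : Fin 1 => if i.val + j.val + 1 = 1 then (1 : L) else 0)).Local v)) (η * ζ⁻¹, (1 : (UnitaryGroup.cmDatum L 1 (Matrix.of fun i j : Fin 1 => if i.val + j.val + 1 = 1 then (1 : L) else 0)).Local v)) := by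
      have h := hst_div _ _ hst
      rwa [mul_inv_cancel_right] at h
    obtain ⟨δ₁, hδ₁U, hst₁, hΨδ₁⟩ := hSst _ hγ _ hst'
    refine ⟨δ₁ * ζ, ?_, ?_, ?_⟩
    · rw [Set.mem_setOf_eq, mul_inv_cancel_right]
      exact hδ₁U
    · have h := hst_mul _ _ hst₁
      rwa [inv_mul_cancel_right] at h
    · show Ψ (δ₁ * ζ * ζ⁻¹) * ζ = η
      rw [mul_inv_cancel_right, hΨδ₁, inv_mul_cancel_right]
  · -- (C)
    intro γ hγ
    rw [Set.mem_setOf_eq] at hγ ⊢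
    show Ψ (γ * ζ⁻¹) * ζ * ζ⁻¹ ∈ U₀
    rw [mul_inv_cancel_right]
    exact hC _ hγ
  · -- (Q): exponents off `⟦ζ⟧`
    intro u hne
    refine ha _ fun heq => hne ?_
    have h1 : Quotient.out u * ζ⁻¹ = 1 := isConj_one_left.1 (ConjClasses.mk_eq_mk_iff_isConj.1 heq)
    have h2 : Quotient.out u = ζ := by rw [← inv_mul_cancel_right (Quotient.out u) ζ, h1, one_mul]
    calc u = ConjClasses.mk (Quotient.out u) := (Quotient.out_eq u).symm
      _ = ConjClasses.mk ζ := by rw [h2]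
  · -- (RAY⁺)
    intro lam
    obtain ⟨t, htU, hreg, hcpt, hirr, hlim⟩ := hRAY ζ hζ lam
    exact ray_translate L v Ψ U₀ hζc lam htU hreg hcpt hirr hlim
  · -- (SC_ζ)
    intro S₂ mU₂ hunip₂ hadm₂ u hu G hG
    exact classOrbitalIntegral_indicator_comp_translate_eq_mul L v hζ hSC S₂ mU₂ hunip₂ hadm₂ hu G hG

end Summit.HodgeConjecture.HodgeConjecture.Cruxes.H413.K2E3RankOneUnipotentScalingPackageOfIdentity

end
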